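import Literature.Analysis.FluidPDE.SereginSverak2002VertexBlowupLimit
import Literature.Analysis.FluidPDE.SereginSverak2002RadialZoomLimit
import Literature.Analysis.FluidPDE.SereginSverakTangentialEnergy
import Literature.Analysis.FluidPDE.SereginSverakTypeIConsequences
import Literature.Analysis.FluidPDE.SliceL2Convergence
import Literature.Analysis.FluidPDE.SereginSverak2002PairingModulus
import HarnessLib

/-!
# One-sided pressure bounds: the blow-up limit vanishes weakly at the final time

Analysis/FluidPDE proof file (theorems only; no definitions, no named facts) on the discharge
path of `Literature.Analysis.FluidPDE.seregin_sverak_2002` (Seregin–Šverák, ARMA 163 (2002), §4),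
case `p̃ ≥ -K`. Tools at the final slice `u(T)` of a classical solution on `[0, T) × ℝ³`
(`ν = 1`) which is Leray–Hopf on `[0, T]`:

* `SereginSverak2002.isWeaklyDivFree_final` — `u(T)` is weakly divergence free;
* `SereginSverak2002.setIntegral_ball_norm_sq_final_le` — the Morrey bound of the Type I regime,
  `∫_{B(x₀,ρ)} |u(T)|² ≤ 2(‖u(0)‖₂² + 4πK) ρ` (`ρ ≤ 1/2`), passes to `t = T` (weak `L²`
  continuity, duality against one test field);
* `SereginSverak2002.exists_subseq_ae_tendsto_pairing` — along a subsequence of the zooms at the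
  vertex, the spatial pairings against a bounded field supported in a ball converge for a.e. time
  (from the `L³` convergence of `exists_blowup_limit_at_vertex`, `SliceL2Convergence.lean`).

## References

* G. Seregin, V. Šverák, Arch. Ration. Mech. Anal. 163 (2002), 65–86, §4. [SereginSverak2002]
-/

noncomputable section

open MeasureTheory TopologicalSpace Set Function Filter Topology Metric InnerProductSpace Real
open scoped ENNReal NNReal RealInnerProductSpace ContDiff

namespace Literature.Analysis.FluidPDE

namespace SereginSverak2002

variable {T : ℝ} {u : ℝ → EuclideanSpace ℝ (Fin 3) → EuclideanSpace ℝ (Fin 3)}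
  {p : ℝ → EuclideanSpace ℝ (Fin 3) → ℝ}

/-! ### The final slice is weakly divergence free -/

/-- **`u(T)` is weakly divergence free**: the classical slices `u(t)`, `t < T`, are divergence free,
and `t ↦ ∫ ⟪u(t), ∇θ⟫` is continuous on `(0, T]`. [folklore] -/
theorem isWeaklyDivFree_final {ν : ℝ} (hT : 0 < T)
    (hsol : IsClassicalNSSolutionOn (Ico 0 T) ν 0 u p) (hLH : IsLerayHopfOn T ν 0 (u 0) u) :
    IsWeaklyDivFree (u T) := by
  intro θ hθ
  have hgc : Continuous fun y => gradient θ y := by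
    have : (fun y => gradient θ y) = (InnerProductSpace.toDual ℝ (EuclideanSpace ℝ (Fin 3))).symm ∘
        fun y => fderiv ℝ θ y := rfl
    rw [this]
    exact (LinearIsometryEquiv.continuous _).comp (hθ.contDiff.continuous_fderiv (by simp))
  have hgs : HasCompactSupport fun y => gradient θ y := by
    have : (fun y => gradient θ y) = (InnerProductSpace.toDual ℝ (EuclideanSpace ℝ (Fin 3))).symm ∘
        fun y => fderiv ℝ θ y := rfl
    rw [this]
    exact (hθ.hasCompactSupport.fderiv ℝ).comp_left (map_zero _)
  have hmem : MemLp (fun y => gradient θ y) 2 volume := hgc.memLp_of_hasCompactSupport hgs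
  have hcont := (hLH.weak_continuous _ hmem).1
  have hzero : ∀ t ∈ Ioo 0 T, ∫ x, ⟪u t x, gradient θ x⟫ = 0 := by
    intro t ht
    have hu1 : ContDiff ℝ 1 (u t) := contDiff_infty.1 (hsol.contDiff_velocity ⟨ht.1.le, ht.2⟩) 1
    exact VectorCalculus.IsDivFree.isWeaklyDivFree_holds (hsol.divFree t ⟨ht.1.le, ht.2⟩) hu1 θ hθ
  -- the value at `T` is the limit of the values `0` from the left
  have h1 : ContinuousWithinAt (fun t => ∫ x, ⟪u t x, gradient θ x⟫) (Ioc 0 T) T := hcont T ⟨hT, le_rfl⟩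
  have h2 : Tendsto (fun t => ∫ x, ⟪u t x, gradient θ x⟫) (𝓝[<] T) (𝓝 (∫ x, ⟪u T x, gradient θ x⟫)) := by
    have h : Tendsto (fun t => ∫ x, ⟪u t x, gradient θ x⟫) (𝓝[Ioc 0 T] T)
        (𝓝 (∫ x, ⟪u T x, gradient θ x⟫)) := h1.tendsto
    rw [nhdsWithin_Ioc_eq_nhdsLE hT] at h
    exact h.mono_left (nhdsWithin_mono _ Iio_subset_Iic_self)
  have h3 : Tendsto (fun t => ∫ x, ⟪u t x, gradient θ x⟫) (𝓝[<] T) (𝓝 0) := by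
    refine (tendsto_const_nhds (x := (0 : ℝ))).congr' ?_
    filter_upwards [Ioo_mem_nhdsLT hT] with t ht
    exact (hzero t ht).symm
  exact tendsto_nhds_unique h2 h3

/-! ### The Morrey bound at the final time -/

/-- **The Morrey bound passes to the final time**: `∫_{B(x₀,ρ)} |u(T)|² ≤ 2(‖u(0)‖₂² + 4πK) ρ`
for `0 < ρ ≤ 1/2`. [folklore] -/
theorem setIntegral_ball_norm_sq_final_le {ν : ℝ} (hν : 0 ≤ ν) (hT : 0 < T)
    (hsol : IsClassicalNSSolutionOn (Ico 0 T) ν 0 u p) (hLH : IsLerayHopfOn T ν 0 (u 0) u)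
    {K : ℝ} (hK : 0 ≤ K)
    (hone : (∀ t ∈ Ioo 0 T, ∀ x, ‖u t x‖ ^ 2 / 2 + normalisedPressure (u t) x ≤ K) ∨
      (∀ t ∈ Ioo 0 T, ∀ x, -K ≤ normalisedPressure (u t) x))
    (x₀ : EuclideanSpace ℝ (Fin 3)) {ρ : ℝ} (hρ : 0 < ρ) (hρ1 : ρ ≤ 1 / 2) :
    ∫ x in ball x₀ ρ, ‖u T x‖ ^ 2 ≤ 2 * ((∫ x, ‖u 0 x‖ ^ 2) + 4 * π * K) * ρ := by
  set M : ℝ := 2 * ((∫ x, ‖u 0 x‖ ^ 2) + 4 * π * K) * ρ with hM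
  have hTI : T ∈ Icc 0 T := ⟨hT.le, le_rfl⟩
  have hbmem : MemLp (u T) 2 volume := hLH.memLp T hTI
  have hbm : AEStronglyMeasurable (u T) volume := hbmem.aestronglyMeasurable
  have hbL2 : Integrable fun x => ‖u T x‖ ^ 2 := hbmem.integrable_norm_pow two_ne_zero
  -- the test field `h = 1_B u(T)`
  set h : EuclideanSpace ℝ (Fin 3) → EuclideanSpace ℝ (Fin 3) := (ball x₀ ρ).indicator (u T) with hh
  have hhmem : MemLp h 2 volume := hbmem.indicator measurableSet_ball
  have hcont := (hLH.weak_continuous h hhmem).1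
  -- `∫ ⟪v, h⟫ = ∫_B ⟪v, u T⟫`
  have hpair : ∀ v : EuclideanSpace ℝ (Fin 3) → EuclideanSpace ℝ (Fin 3),
      ∫ x, ⟪v x, h x⟫ = ∫ x in ball x₀ ρ, ⟪v x, u T x⟫ := by
    intro v
    rw [← integral_indicator measurableSet_ball]
    refine integral_congr_ae (Eventually.of_forall fun x => ?_)
    simp only [hh]
    by_cases hx : x ∈ ball x₀ ρ
    · rw [indicator_of_mem hx, indicator_of_mem hx]
    · rw [indicator_of_notMem hx, indicator_of_notMem hx, inner_zero_right]
  -- for `t < T`: `2∫_B ⟪u t, u T⟫ - ∫_B |u T|² ≤ ∫_B |u t|² ≤ M`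
  have hineq : ∀ t ∈ Ioo 0 T, 2 * (∫ x, ⟪u t x, h x⟫) - ∫ x in ball x₀ ρ, ‖u T x‖ ^ 2 ≤ M := by
    intro t ht
    have htI : t ∈ Icc 0 T := ⟨ht.1.le, ht.2.le⟩
    have hut : MemLp (u t) 2 volume := hLH.memLp t htI
    have hutL2 : Integrable fun x => ‖u t x‖ ^ 2 := hut.integrable_norm_pow two_ne_zero
    have hMor := setIntegral_ball_norm_sq_le_uniform hν hsol hLH hK hone ht x₀ hρ hρ1
    rw [hpair]
    have hcross : IntegrableOn (fun x => ⟪u t x, u T x⟫) (ball x₀ ρ) := by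
      have ib : Integrable (fun x => (‖u t x‖ ^ 2 + ‖u T x‖ ^ 2) / 2) volume := (hutL2.add hbL2).div_const 2
      refine Integrable.mono' ib.integrableOn
        ((hut.aestronglyMeasurable.inner hbm).restrict) (Eventually.of_forall fun x => ?_)
      rw [Real.norm_eq_abs]
      have h1 := abs_real_inner_le_norm (u t x) (u T x)
      nlinarith [sq_nonneg (‖u t x‖ - ‖u T x‖)]
    have hkey : 2 * (∫ x in ball x₀ ρ, ⟪u t x, u T x⟫) - ∫ x in ball x₀ ρ, ‖u T x‖ ^ 2 ≤
        ∫ x in ball x₀ ρ, ‖u t x‖ ^ 2 := by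
      rw [← integral_const_mul, ← integral_sub (hcross.const_mul 2) hbL2.integrableOn]
      refine setIntegral_mono_on ((hcross.const_mul 2).sub hbL2.integrableOn) hutL2.integrableOn
        measurableSet_ball fun x _ => ?_
      have := norm_sub_sq_real (u t x) (u T x)
      nlinarith [sq_nonneg ‖u t x - u T x‖, this]
    exact hkey.trans hMor
  -- pass to the limit `t → T⁻`
  have h1 : ContinuousWithinAt (fun t => ∫ x, ⟪u t x, h x⟫) (Ioc 0 T) T := hcont T ⟨hT, le_rfl⟩
  have h2 : Tendsto (fun t => ∫ x, ⟪u t x, h x⟫) (𝓝[<] T) (𝓝 (∫ x, ⟪u T x, h x⟫)) := by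
    have h' : Tendsto (fun t => ∫ x, ⟪u t x, h x⟫) (𝓝[Ioc 0 T] T) (𝓝 (∫ x, ⟪u T x, h x⟫)) := h1.tendsto
    rw [nhdsWithin_Ioc_eq_nhdsLE hT] at h'
    exact h'.mono_left (nhdsWithin_mono _ Iio_subset_Iic_self)
  have hev : ∀ᶠ t in 𝓝[<] T, 2 * (∫ x, ⟪u t x, h x⟫) - ∫ x in ball x₀ ρ, ‖u T x‖ ^ 2 ≤ M := by
    filter_upwards [Ioo_mem_nhdsLT hT] with t ht using hineq t ht
  have hlim := le_of_tendsto ((h2.const_mul 2).sub_const (∫ x in ball x₀ ρ, ‖u T x‖ ^ 2)) hev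
  rw [hpair] at hlim
  have hself : ∫ x in ball x₀ ρ, ⟪u T x, u T x⟫ = ∫ x in ball x₀ ρ, ‖u T x‖ ^ 2 := by
    refine integral_congr_ae (Eventually.of_forall fun x => ?_)
    exact real_inner_self_eq_norm_sq _
  rw [hself] at hlim
  linarith

/-! ### Slices of the zooms along a subsequence -/

set_option maxHeartbeats 800000 in
/-- **Pairings of the zoom slices converge for a.e. time along a subsequence.** From the `L³`
convergence of the zooms `u_{R_j}` to `w` on `Q(a) = (-a², 0) × B(0, a)` and a bounded field `φ`
supported in `B(0, a)`: along a subsequence, `∫ ⟪u_{R_j}(s), φ⟫ → ∫ ⟪w(s), φ⟫` for a.e.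
`s ∈ (-a², 0)`. [folklore] -/
theorem exists_subseq_ae_tendsto_pairing (hT : 0 < T) (hsol : IsClassicalNSSolutionOn (Ico 0 T) 1 0 u p)
    (x₀ : EuclideanSpace ℝ (Fin 3)) {R : ℕ → ℝ} (hRpos : ∀ j, 0 < R j) (hR0 : Tendsto R atTop (𝓝 0))
    {w : ℝ → EuclideanSpace ℝ (Fin 3) → EuclideanSpace ℝ (Fin 3)} {a : ℝ}
    (hw3 : MemLp (uncurry w) 3
      (volume.restrict (parabolicCylinder a (0 : ℝ × EuclideanSpace ℝ (Fin 3)))))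
    (hconv : Tendsto (fun j => eLpNorm
        (uncurry ((R j) • stPull ((R j) ^ 2) (R j) T x₀ u) - uncurry w) 3
        (volume.restrict (parabolicCylinder a (0 : ℝ × EuclideanSpace ℝ (Fin 3)))))
      atTop (𝓝 0))
    {φ : EuclideanSpace ℝ (Fin 3) → EuclideanSpace ℝ (Fin 3)} (hφc : Continuous φ) {M : ℝ}
    (hφM : ∀ y, ‖φ y‖ ≤ M) (hφs : ∀ y, y ∉ ball (0 : EuclideanSpace ℝ (Fin 3)) a → φ y = 0) :
    ∃ κ : ℕ → ℕ, StrictMono κ ∧ ∀ᵐ s ∂(volume.restrict (Ioo (-a ^ 2) 0)),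
      Tendsto (fun k => ∫ y, ⟪(R (κ k)) • u (T + (R (κ k)) ^ 2 * s) (x₀ + (R (κ k)) • y), φ y⟫) atTop
        (𝓝 (∫ y, ⟪w s y, φ y⟫)) := by
  set I : Set ℝ := Ioo (-a ^ 2) 0 with hI
  set B : Set (EuclideanSpace ℝ (Fin 3)) := ball (0 : EuclideanSpace ℝ (Fin 3)) a with hB
  have hQ : parabolicCylinder a (0 : ℝ × EuclideanSpace ℝ (Fin 3)) = I ×ˢ B := by
    rw [parabolicCylinder]; simp [hI, hB]
  rw [hQ] at hw3 hconv
  have hIBm : MeasurableSet (I ×ˢ B) := measurableSet_Ioo.prod measurableSet_ball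
  set μQ : Measure (ℝ × EuclideanSpace ℝ (Fin 3)) := volume.restrict (I ×ˢ B) with hμQ
  have hfinQ : volume (I ×ˢ B) < ⊤ :=
    ((isCompact_Icc.prod (isCompact_closedBall _ _)).measure_lt_top).trans_le'
      (measure_mono (prod_mono Ioo_subset_Icc_self ball_subset_closedBall))
  haveI : IsFiniteMeasure μQ := ⟨by rw [hμQ, Measure.restrict_apply_univ]; exact hfinQ⟩
  -- the tail where the zooms are classical on `Q(a)`
  have hev : ∀ᶠ j in atTop, a ^ 2 * R j ^ 2 < T := by
    have h1 : Tendsto (fun j => a ^ 2 * R j ^ 2) atTop (𝓝 (a ^ 2 * 0 ^ 2)) := (hR0.pow 2).const_mul _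
    rw [zero_pow two_ne_zero, mul_zero] at h1
    exact h1.eventually (Iio_mem_nhds hT)
  obtain ⟨J₀, hJ₀⟩ := eventually_atTop.1 hev
  -- the zoom fields of the tail
  set f : ℕ → ℝ → EuclideanSpace ℝ (Fin 3) → EuclideanSpace ℝ (Fin 3) :=
    fun k s y => (R (J₀ + k)) • u (T + (R (J₀ + k)) ^ 2 * s) (x₀ + (R (J₀ + k)) • y) with hf
  have hf_eq : ∀ k, uncurry (f k) = uncurry ((R (J₀ + k)) • stPull ((R (J₀ + k)) ^ 2) (R (J₀ + k)) T x₀ u) :=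
    fun k => rfl
  have htime : ∀ k, ∀ s ∈ I, T + (R (J₀ + k)) ^ 2 * s ∈ Ico 0 T := by
    intro k s hs
    have hR2 : 0 < R (J₀ + k) ^ 2 := pow_pos (hRpos _) 2
    have h1 := hJ₀ (J₀ + k) (Nat.le_add_right _ _)
    have h2 : R (J₀ + k) ^ 2 * (-a ^ 2) < R (J₀ + k) ^ 2 * s := mul_lt_mul_of_pos_left hs.1 hR2
    have h3 : R (J₀ + k) ^ 2 * s < 0 := mul_neg_of_pos_of_neg hR2 hs.2
    exact ⟨by nlinarith, by linarith⟩
  have hu := continuousOn_uncurry hsol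
  have hfc : ∀ k, ContinuousOn (uncurry (f k)) (I ×ˢ (univ : Set (EuclideanSpace ℝ (Fin 3)))) := by
    intro k
    have e : uncurry (f k) = fun z : ℝ × EuclideanSpace ℝ (Fin 3) =>
        (R (J₀ + k)) • uncurry u (T + (R (J₀ + k)) ^ 2 * z.1, x₀ + (R (J₀ + k)) • z.2) := by
      funext z; rfl
    rw [e]
    have hA : Continuous fun z : ℝ × EuclideanSpace ℝ (Fin 3) =>
        (T + (R (J₀ + k)) ^ 2 * z.1, x₀ + (R (J₀ + k)) • z.2) := by fun_prop
    have hB : ContinuousOn (fun z : ℝ × EuclideanSpace ℝ (Fin 3) =>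
        uncurry u (T + (R (J₀ + k)) ^ 2 * z.1, x₀ + (R (J₀ + k)) • z.2)) (I ×ˢ univ) :=
      hu.comp hA.continuousOn fun z hz => ⟨htime k z.1 hz.1, mem_univ _⟩
    exact hB.const_smul (R (J₀ + k))
  have hfm : ∀ k, AEStronglyMeasurable (uncurry (f k)) μQ := fun k =>
    ((hfc k).aestronglyMeasurable (measurableSet_Ioo.prod MeasurableSet.univ)).mono_measure
      (Measure.restrict_mono (prod_mono subset_rfl (subset_univ _)) le_rfl)
  have hwm : AEStronglyMeasurable (uncurry w) μQ := hw3.aestronglyMeasurable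
  -- `L³ → L²` on the finite measure `μQ`
  have h23 : ∀ {g : ℝ × EuclideanSpace ℝ (Fin 3) → EuclideanSpace ℝ (Fin 3)}, AEStronglyMeasurable g μQ →
      ∫⁻ z, ‖g z‖ₑ ^ 2 ∂μQ ≤ (eLpNorm g 3 μQ * μQ univ ^ (1 / 2 - 1 / 3 : ℝ)) ^ 2 := by
    intro g hg
    have h1 := eLpNorm_le_eLpNorm_mul_rpow_measure_univ (p := 2) (q := 3) (μ := μQ) (by norm_num) hg
    have e : ∫⁻ z, ‖g z‖ₑ ^ 2 ∂μQ = eLpNorm g 2 μQ ^ 2 := by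
      rw [eLpNorm_eq_lintegral_rpow_enorm_toReal two_ne_zero ENNReal.ofNat_ne_top]
      simp only [ENNReal.toReal_ofNat, ENNReal.rpow_ofNat, one_div]
      rw [← ENNReal.rpow_natCast, ← ENNReal.rpow_mul]
      norm_num
    rw [e]
    simp only [ENNReal.toReal_ofNat] at h1
    gcongr
  have hL2 : Tendsto (fun k => ∫⁻ z in I ×ˢ B, ‖f k z.1 z.2 - w z.1 z.2‖ₑ ^ 2) atTop (𝓝 0) := by
    have hc := hconv.comp (tendsto_add_atTop_nat J₀)
    have hc' : Tendsto (fun k => eLpNorm (uncurry (f k) - uncurry w) 3 μQ) atTop (𝓝 0) := by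
      refine hc.congr fun k => ?_
      simp only [Function.comp, hf_eq, hμQ, add_comm J₀ k]
    have hb : Tendsto (fun k => (eLpNorm (uncurry (f k) - uncurry w) 3 μQ * μQ univ ^ (1 / 2 - 1 / 3 : ℝ)) ^ 2)
        atTop (𝓝 0) := by
      have h1 := ENNReal.Tendsto.mul_const hc' (Or.inr (ENNReal.rpow_ne_top_of_nonneg
        (by norm_num : (0 : ℝ) ≤ 1 / 2 - 1 / 3) (measure_ne_top μQ univ)))
      rw [zero_mul] at h1
      have h2 := ENNReal.Tendsto.pow (n := 2) h1
      rwa [zero_pow two_ne_zero] at h2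
    refine tendsto_of_tendsto_of_tendsto_of_le_of_le tendsto_const_nhds hb (fun k => bot_le) fun k => ?_
    exact h23 ((hfm k).sub hwm)
  obtain ⟨τ, hτ, hae⟩ := exists_subseq_ae_tendsto_lintegral_slice (I := I) (B := B) hfm hwm hL2
  -- slice facts for `w`
  have hprod : μQ = (volume.restrict I).prod (volume.restrict B) := by
    rw [hμQ, Measure.prod_restrict, ← Measure.volume_eq_prod]
  have hwslice_m : ∀ᵐ s ∂(volume.restrict I), AEStronglyMeasurable (w s) (volume.restrict B) := by
    have h := hwm
    rw [hprod] at h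
    exact h.prodMk_left
  have hwslice_2 : ∀ᵐ s ∂(volume.restrict I), ∫⁻ y in B, ‖w s y‖ₑ ^ 2 < ⊤ := by
    have hw2 : ∫⁻ z, ‖uncurry w z‖ₑ ^ 2 ∂μQ < ⊤ := by
      refine lt_of_le_of_lt (h23 hwm) ?_
      exact ENNReal.pow_lt_top (ENNReal.mul_lt_top hw3.eLpNorm_lt_top
        (ENNReal.rpow_lt_top_of_nonneg (by norm_num : (0 : ℝ) ≤ 1 / 2 - 1 / 3) (measure_ne_top μQ univ)))
    rw [hprod, lintegral_prod _ (hwm.aemeasurable.enorm.pow_const 2 |>.mono_measure (by rw [hprod]))] at hw2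
    refine ae_lt_top' ?_ hw2.ne
    exact ((hwm.aemeasurable.enorm.pow_const 2).mono_measure (by rw [hprod])).lintegral_prod_right'
  -- combine
  refine ⟨fun k => J₀ + τ k, fun m n hmn => by simpa using hτ hmn, ?_⟩
  have hμB : (volume.restrict B) univ < ⊤ := by rw [Measure.restrict_apply_univ]; exact measure_ball_lt_top
  filter_upwards [hae, hwslice_m, hwslice_2, ae_restrict_mem measurableSet_Ioo] with s hs hsm hs2 hsI
  -- the slices of the tail are continuous
  have hslc : ∀ k, Continuous (f k s) := by
    intro k
    have h1 : Continuous (u (T + (R (J₀ + k)) ^ 2 * s)) := (hsol.contDiff_velocity (htime k s hsI)).continuous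
    show Continuous fun y => (R (J₀ + k)) • u (T + (R (J₀ + k)) ^ 2 * s) (x₀ + (R (J₀ + k)) • y)
    fun_prop
  have hslf : ∀ k, ∫⁻ y in (univ : Set (EuclideanSpace ℝ (Fin 3))), ‖f k s y‖ₑ ^ 2 ∂(volume.restrict B) < ⊤ := by
    intro k
    rw [Measure.restrict_univ]
    obtain ⟨C, hC⟩ := (isCompact_closedBall (0 : EuclideanSpace ℝ (Fin 3)) a).exists_bound_of_continuousOn
      (hslc k).continuousOn
    calc ∫⁻ y in B, ‖f k s y‖ₑ ^ 2 ≤ ∫⁻ _ in B, ENNReal.ofReal (C ^ 2) := by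
          refine setLIntegral_mono' measurableSet_ball fun y hy => ?_
          rw [← ofReal_norm, ← ENNReal.ofReal_pow (norm_nonneg _)]
          exact ENNReal.ofReal_le_ofReal (pow_le_pow_left₀ (norm_nonneg _) (hC y (ball_subset_closedBall hy)) 2)
      _ < ⊤ := by rw [setLIntegral_const]; exact ENNReal.mul_lt_top ENNReal.ofReal_lt_top measure_ball_lt_top
  have key := tendsto_integral_inner_of_tendsto_lintegral (μ := volume.restrict B)
    (f := fun k => f (τ k) s) (g := w s) (η := φ) (B := univ)
    (fun k => (hslc (τ k)).aestronglyMeasurable) hsm hφc.aestronglyMeasurable hφM hμB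
    (fun y hy => absurd (mem_univ y) hy) (fun k => hslf (τ k)) (by rwa [Measure.restrict_univ])
    (by simpa [Measure.restrict_univ] using hs)
  -- full-space pairings
  have hfull : ∀ g : EuclideanSpace ℝ (Fin 3) → EuclideanSpace ℝ (Fin 3),
      ∫ y, ⟪g y, φ y⟫ ∂(volume.restrict B) = ∫ y, ⟪g y, φ y⟫ := by
    intro g
    exact setIntegral_eq_integral_of_forall_compl_eq_zero fun y hy => by rw [hφs y hy, inner_zero_right]
  simp only [hfull] at key
  exact key

/-! ### The blow-up limit vanishes weakly at the final time -/

/-- Elementary: `C(δ + δ^{1/3})`-type smallness. For `0 < η`, `0 ≤ C` there is `δ ∈ (0, 1]` with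
`C (|s| + |s|^{1/3}) ≤ η` whenever `|s| < δ`. [folklore] -/
theorem exists_delta_modulus_le {C η : ℝ} (hC : 0 ≤ C) (hη : 0 < η) :
    ∃ δ > 0, δ ≤ 1 ∧ ∀ s : ℝ, |s| < δ → C * (|s| + |s| ^ (1 / 3 : ℝ)) ≤ η := by
  set e : ℝ := η / (2 * (C + 1)) with he
  have he0 : 0 < e := by positivity
  refine ⟨min 1 (min e (e ^ 3)), lt_min one_pos (lt_min he0 (by positivity)), min_le_left _ _, fun s hs => ?_⟩
  have hs1 : |s| < e := lt_of_lt_of_le hs ((min_le_right _ _).trans (min_le_left _ _))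
  have hs3 : |s| < e ^ 3 := lt_of_lt_of_le hs ((min_le_right _ _).trans (min_le_right _ _))
  have hroot : |s| ^ (1 / 3 : ℝ) ≤ e := by
    have h1 : |s| ^ (1 / 3 : ℝ) ≤ (e ^ 3) ^ (1 / 3 : ℝ) := Real.rpow_le_rpow (abs_nonneg _) hs3.le (by norm_num)
    have h2 : (e ^ 3) ^ (1 / 3 : ℝ) = e := by
      rw [show (e ^ 3 : ℝ) = e ^ (3 : ℝ) by norm_cast, ← Real.rpow_mul he0.le]; norm_num
    linarith [h2 ▸ h1]
  calc C * (|s| + |s| ^ (1 / 3 : ℝ)) ≤ C * (e + e) := by gcongr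
    _ = C * η / (C + 1) := by rw [he]; field_simp; ring
    _ ≤ η := by rw [div_le_iff₀ (by positivity)]; nlinarith

set_option maxHeartbeats 800000 in
/-- **The blow-up limit vanishes weakly at the final time** (case `p̃ ≥ -K`). Let `w` be the
`L³(Q(a))`-limit of the zooms `u_{R_j}` at the vertex `(T, x₀)`, `R_j → 0⁺`. Then for every test
field `φ ∈ C_c^∞(B(0, a))` and `η > 0` there is `δ > 0` with `|∫ ⟪w(s), φ⟫| ≤ η` for a.e.
`s ∈ (-δ, 0)`: the time modulus of `zoom_pairing_modulus` is uniform in the scale, and the zooms of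
the final value `u(T)` converge weakly to zero (`tendsto_integral_inner_zoom`, by the finite
log-tangential energy `exists_tangential_final_bound`). [cite: SereginSverak2002, §4] -/
theorem ae_abs_pairing_le_near_top (hT : 0 < T)
    (hsol : IsClassicalNSSolutionOn (Ico 0 T) 1 0 u p) (hLH : IsLerayHopfOn T 1 0 (u 0) u)
    {K : ℝ} (hK : 0 ≤ K) (hfloor : ∀ t ∈ Ioo 0 T, ∀ x, -K ≤ normalisedPressure (u t) x)
    (x₀ : EuclideanSpace ℝ (Fin 3)) {R : ℕ → ℝ} (hRpos : ∀ j, 0 < R j) (hR0 : Tendsto R atTop (𝓝 0))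
    {w : ℝ → EuclideanSpace ℝ (Fin 3) → EuclideanSpace ℝ (Fin 3)} {a : ℝ} (ha : 1 ≤ a)
    (hw3 : MemLp (uncurry w) 3
      (volume.restrict (parabolicCylinder a (0 : ℝ × EuclideanSpace ℝ (Fin 3)))))
    (hconv : Tendsto (fun j => eLpNorm
        (uncurry ((R j) • stPull ((R j) ^ 2) (R j) T x₀ u) - uncurry w) 3
        (volume.restrict (parabolicCylinder a (0 : ℝ × EuclideanSpace ℝ (Fin 3)))))
      atTop (𝓝 0))
    {φ : EuclideanSpace ℝ (Fin 3) → EuclideanSpace ℝ (Fin 3)} (hφ : ContDiff ℝ ∞ φ)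
    (hφc : HasCompactSupport φ) (hφa : tsupport φ ⊆ ball (0 : EuclideanSpace ℝ (Fin 3)) a)
    {η : ℝ} (hη : 0 < η) :
    ∃ δ > 0, ∀ᵐ s ∂(volume : Measure ℝ), s ∈ Ioo (-δ) 0 → |∫ y, ⟪w s y, φ y⟫| ≤ η := by
  have ha0 : 0 < a := by linarith
  have hone : (∀ t ∈ Ioo 0 T, ∀ x, ‖u t x‖ ^ 2 / 2 + normalisedPressure (u t) x ≤ K) ∨
      (∀ t ∈ Ioo 0 T, ∀ x, -K ≤ normalisedPressure (u t) x) := Or.inr hfloor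
  -- the modulus and the threshold
  obtain ⟨C, hC0, R₀, hR₀, hmod⟩ := zoom_pairing_modulus hT hsol hLH hK hone x₀ hφ hφc ha hφa
  obtain ⟨δ, hδ, hδ1, hδC⟩ := exists_delta_modulus_le hC0 hη
  refine ⟨δ, hδ, ?_⟩
  -- the field is bounded and supported in the ball
  have hφs : ∀ y, y ∉ ball (0 : EuclideanSpace ℝ (Fin 3)) a → φ y = 0 := fun y hy =>
    image_eq_zero_of_notMem_tsupport fun h => hy (hφa h)
  obtain ⟨M, hM⟩ := hφ.continuous.bounded_above_of_compact_support hφc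
  -- slices of the zooms along a subsequence
  obtain ⟨κ, hκ, hae⟩ := exists_subseq_ae_tendsto_pairing hT hsol x₀ hRpos hR0 hw3 hconv hφ.continuous hM hφs
  -- the zooms of the final value converge weakly to zero
  have hTI : T ∈ Icc 0 T := ⟨hT.le, le_rfl⟩
  have hb2 : MemLp (u T) 2 volume := hLH.memLp T hTI
  have hdiv := isWeaklyDivFree_final hT hsol hLH
  set MA : ℝ := 2 * ((∫ x, ‖u 0 x‖ ^ 2) + 4 * π * K) with hMA
  have hMA0 : 0 ≤ MA := by
    have : 0 ≤ ∫ x, ‖u 0 x‖ ^ 2 := integral_nonneg fun x => sq_nonneg _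
    positivity
  have hMorrey : ∀ r, 0 < r → r ≤ 1 / 2 → ∫ x in ball x₀ r, ‖u T x‖ ^ 2 ≤ MA * r := fun r hr hr1 =>
    setIntegral_ball_norm_sq_final_le zero_le_one hT hsol hLH hK hone x₀ hr hr1
  obtain ⟨Bt, -, -, htan⟩ := exists_tangential_final_bound zero_le_one hT hsol hLH hK hfloor x₀
  have hφ2 : MemLp φ 2 volume := hφ.continuous.memLp_of_hasCompactSupport hφc
  have hZ : Tendsto (fun k => ∫ y, ⟪R (κ k) • u T (x₀ + R (κ k) • y), φ y⟫) atTop (𝓝 0) :=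
    tendsto_integral_inner_zoom hb2 hdiv x₀ hMA0 (by norm_num : (0 : ℝ) < 1 / 2) hMorrey
      (ne_top_of_le_ne_top ENNReal.ofReal_ne_top htan) hφ2 hφs (fun k => hRpos _)
      (hR0.comp hκ.tendsto_atTop)
  -- eventually the scales are below `R₀`
  have hevR : ∀ᶠ k in atTop, R (κ k) ≤ R₀ :=
    (hR0.comp hκ.tendsto_atTop).eventually (Iic_mem_nhds hR₀)
  -- conclude for a.e. `s`
  have hae' := (ae_restrict_iff' measurableSet_Ioo).1 hae
  filter_upwards [hae'] with s hs hsδ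
  have hsa : s ∈ Ioo (-a ^ 2) 0 := ⟨by nlinarith [hsδ.1, hδ1, ha], hsδ.2⟩
  have hs1 : s ∈ Ioo (-1 : ℝ) 0 := ⟨by linarith [hsδ.1], hsδ.2⟩
  have hsabs : |s| < δ := by rw [abs_of_neg hsδ.2]; linarith [hsδ.1]
  have hlimP := (hs hsa).abs
  have hev : ∀ᶠ k in atTop, |∫ y, ⟪R (κ k) • u (T + R (κ k) ^ 2 * s) (x₀ + R (κ k) • y), φ y⟫| ≤
      |∫ y, ⟪R (κ k) • u T (x₀ + R (κ k) • y), φ y⟫| + C * (|s| + |s| ^ (1 / 3 : ℝ)) := by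
    filter_upwards [hevR] with k hk
    have h := hmod (R (κ k)) (hRpos _) hk s hs1
    have := abs_sub_abs_le_abs_sub (∫ y, ⟪R (κ k) • u (T + R (κ k) ^ 2 * s) (x₀ + R (κ k) • y), φ y⟫)
      (∫ y, ⟪R (κ k) • u T (x₀ + R (κ k) • y), φ y⟫)
    linarith
  have hlimZ : Tendsto (fun k => |∫ y, ⟪R (κ k) • u T (x₀ + R (κ k) • y), φ y⟫| + C * (|s| + |s| ^ (1 / 3 : ℝ)))
      atTop (𝓝 (0 + C * (|s| + |s| ^ (1 / 3 : ℝ)))) := by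
    have := hZ.abs
    rw [abs_zero] at this
    exact this.add_const _
  have hle := le_of_tendsto_of_tendsto hlimP hlimZ hev
  rw [zero_add] at hle
  exact hle.trans (hδC s hsabs)

end SereginSverak2002

end Literature.Analysis.FluidPDE

end
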